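import Literature.NumberTheory.LFunctions.ProlateExistsUnique
import HarnessLib

/-!
# Connes–Consani 2021, Lemma 5.4 numerics: the geometric tail of the Frobenius coefficients from the
# four-term recursion (PROVED, no numerics)

RH-FREE corpus literature (label, line 1): an induction on the recursion
`2(k+1)² a_{k+1} = (k(k+1) − b + 4π²) a_k − 8π² a_{k−1} + 4π² a_{k−2}` (`frobCoeff_rec`, `λ = 1`)
turning three certified starting bounds `|a_{K}|, |a_{K+1}|, |a_{K+2}| ≤ B qᵏ` and the criterion
`(k(k+1)+c)q² + 8π²q + 4π² ≤ 2(k+1)²q³` (`k ≥ K+2`, `c ≥ |4π² − b|`) into `|a_k| ≤ B qᵏ` for all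
`k ≥ K`, hence `Σ_j |a_{j+K}| ≤ B q^K/(1−q)` — the tail constant a kernel certificate of
`ε′(1⁺) = Σ t(n)` feeds into `EpsSlopeFrobeniusToolkit/Integrals`.  Nothing in this file mentions
`ζ`, the critical strip or RH, and nothing here bears on the truth of RH.  bears_on (cell rh-crit,
corpus C1): apex input (B) — route «ConnesConsaniSemilocal» item K2 `DensitySlope` (stmt 19308),
the (E-b) conjunct of `CC2021_section6_enclosures` (cc R70 tier 2).

Sources: A. Connes, C. Consani, *Weil positivity and trace formula, the archimedean place*, Selecta
Math. (N.S.) 27 (2021) 77 = arXiv:2006.13771 [bib `ConnesConsani2021`], Lemma 5.4 §5 pp. 32–33;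
[Coddington–Levinson 1955, Ch. 4 §8] (majorisation of Frobenius coefficients by a geometric
sequence — the convergence proof).

## What is here (all PROVED, 0 definitions, 0 facts)

* `abs_frobCoeff_le_geometric` — the induction;
* `tsum_abs_frobCoeff_add_le` — `Σ_j |a_{j+K}| ≤ B q^K/(1−q)` (`0 < q < 1`);
* `criterion_of_quadratic` — the criterion for all `k ≥ K₀` from its value at `K₀` and a
  nonnegative discrete derivative (`2q³ − q² ≥ 0`), so a certificate checks two numbers.

WHAT THIS IS NOT: no numerics; nothing about `ζ` or RH.
-/

noncomputable section

open Real Set Filter Topology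

namespace Literature.NumberTheory.LFunctions

/-- One step of the recursion in absolute value (`λ = 1`, `k ≥ 2`):
`2(k+1)²|a_{k+1}| ≤ (k(k+1) + c)|a_k| + 8π²|a_{k−1}| + 4π²|a_{k−2}|` for `c ≥ |4π² − b|`.
[cite: CoddingtonLevinson1955, Ch. 4 §8] -/
theorem abs_frobCoeff_succ_le {b c : ℝ} (hc : |4 * π ^ 2 - b| ≤ c) (k : ℕ) :
    2 * ((k : ℝ) + 2 + 1) ^ 2 * |frobCoeff 1 b (k + 2 + 1)|
      ≤ (((k : ℝ) + 2) * ((k : ℝ) + 2 + 1) + c) * |frobCoeff 1 b (k + 2)|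
        + 8 * π ^ 2 * |frobCoeff 1 b (k + 1)| + 4 * π ^ 2 * |frobCoeff 1 b k| := by
  have hrec := frobCoeff_rec (lam := 1) (χ := b) one_ne_zero (k + 2)
  simp only [frobPrev_succ, frobPrev₂_succ, one_pow, mul_one] at hrec
  push_cast at hrec
  have hk0 : (0 : ℝ) ≤ (k : ℝ) := Nat.cast_nonneg k
  have hpos : 0 < 2 * ((k : ℝ) + 2 + 1) ^ 2 := by positivity
  rw [← abs_of_pos hpos, ← abs_mul, hrec]
  have hcoef : |((k : ℝ) + 2) * ((k : ℝ) + 2 + 1) - b + 4 * π ^ 2|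
      ≤ ((k : ℝ) + 2) * ((k : ℝ) + 2 + 1) + c := by
    calc |((k : ℝ) + 2) * ((k : ℝ) + 2 + 1) - b + 4 * π ^ 2|
        = |((k : ℝ) + 2) * ((k : ℝ) + 2 + 1) + (4 * π ^ 2 - b)| := by ring_nf
      _ ≤ |((k : ℝ) + 2) * ((k : ℝ) + 2 + 1)| + |4 * π ^ 2 - b| := abs_add_le _ _
      _ ≤ ((k : ℝ) + 2) * ((k : ℝ) + 2 + 1) + c := by
          rw [abs_of_nonneg (by positivity)]; linarith
  calc |(((k : ℝ) + 2) * ((k : ℝ) + 2 + 1) - b + 4 * π ^ 2) * frobCoeff 1 b (k + 2)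
        - 8 * π ^ 2 * frobCoeff 1 b (k + 1) + 4 * π ^ 2 * frobCoeff 1 b k|
      ≤ |(((k : ℝ) + 2) * ((k : ℝ) + 2 + 1) - b + 4 * π ^ 2) * frobCoeff 1 b (k + 2)
          - 8 * π ^ 2 * frobCoeff 1 b (k + 1)| + |4 * π ^ 2 * frobCoeff 1 b k| := abs_add_le _ _
    _ ≤ |(((k : ℝ) + 2) * ((k : ℝ) + 2 + 1) - b + 4 * π ^ 2) * frobCoeff 1 b (k + 2)|
          + |8 * π ^ 2 * frobCoeff 1 b (k + 1)| + |4 * π ^ 2 * frobCoeff 1 b k| :=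
        add_le_add (abs_sub _ _) le_rfl
    _ ≤ _ := by
        have e1 : |(((k : ℝ) + 2) * ((k : ℝ) + 2 + 1) - b + 4 * π ^ 2) * frobCoeff 1 b (k + 2)|
            = |((k : ℝ) + 2) * ((k : ℝ) + 2 + 1) - b + 4 * π ^ 2| * |frobCoeff 1 b (k + 2)| :=
          abs_mul _ _
        have e8 : |8 * π ^ 2 * frobCoeff 1 b (k + 1)| = 8 * π ^ 2 * |frobCoeff 1 b (k + 1)| := by
          rw [abs_mul, abs_of_nonneg (by positivity : (0:ℝ) ≤ 8 * π ^ 2)]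
        have e4 : |4 * π ^ 2 * frobCoeff 1 b k| = 4 * π ^ 2 * |frobCoeff 1 b k| := by
          rw [abs_mul, abs_of_nonneg (by positivity : (0:ℝ) ≤ 4 * π ^ 2)]
        rw [e1, e8, e4]
        have h0 : 0 ≤ |frobCoeff 1 b (k + 2)| := abs_nonneg _
        have := mul_le_mul_of_nonneg_right hcoef h0
        linarith

/-- **Geometric majorisation of the Frobenius coefficients by induction on the recursion**: if
`|a_K|, |a_{K+1}|, |a_{K+2}| ≤ B qᵏ` and `(k(k+1) + c)q² + 8π²q + 4π² ≤ 2(k+1)²q³` for all `k ≥ K+2`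
(`c ≥ |4π² − b|`, `q > 0`), then `|a_k| ≤ B qᵏ` for all `k ≥ K`.
[cite: CoddingtonLevinson1955, Ch. 4 §8 (convergence proof)] -/
theorem abs_frobCoeff_le_geometric {b c B q : ℝ} {K : ℕ} (hq : 0 < q) (hc : |4 * π ^ 2 - b| ≤ c)
    (h0 : |frobCoeff 1 b K| ≤ B * q ^ K) (h1 : |frobCoeff 1 b (K + 1)| ≤ B * q ^ (K + 1))
    (h2 : |frobCoeff 1 b (K + 2)| ≤ B * q ^ (K + 2))
    (hcrit : ∀ k : ℕ, K + 2 ≤ k →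
      (((k : ℝ) * ((k : ℝ) + 1) + c) * q ^ 2 + 8 * π ^ 2 * q + 4 * π ^ 2)
        ≤ 2 * ((k : ℝ) + 1) ^ 2 * q ^ 3) :
    ∀ k : ℕ, K ≤ k → |frobCoeff 1 b k| ≤ B * q ^ k := by
  -- strong induction on `k`, three consecutive bounds at a time
  have key : ∀ n : ℕ, |frobCoeff 1 b (K + n)| ≤ B * q ^ (K + n) ∧
      |frobCoeff 1 b (K + n + 1)| ≤ B * q ^ (K + n + 1) ∧
      |frobCoeff 1 b (K + n + 2)| ≤ B * q ^ (K + n + 2) := by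
    intro n
    induction n with
    | zero => exact ⟨by simpa using h0, by simpa using h1, by simpa using h2⟩
    | succ n ih =>
      obtain ⟨ha, hb, hcc⟩ := ih
      refine ⟨hb, hcc, ?_⟩
      -- the new bound at index `K + n + 3` from the recursion at `k = K + n + 2`
      have hstep := abs_frobCoeff_succ_le hc (K + n)
      have hcr := hcrit (K + n + 2) (by omega)
      have e1 : (((K + n : ℕ) : ℝ) + 2) = ((K + n + 2 : ℕ) : ℝ) := by push_cast; ring
      have hk0 : (0 : ℝ) ≤ ((K + n : ℕ) : ℝ) := Nat.cast_nonneg _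
      have hqpow : 0 < q ^ (K + n) := pow_pos hq _
      have hB : 0 ≤ B := by
        have := (abs_nonneg _).trans h0
        have hqK : 0 < q ^ K := pow_pos hq _
        nlinarith
      -- combine
      have hrhs : (((K + n : ℕ) : ℝ) + 2) * (((K + n : ℕ) : ℝ) + 2 + 1) + c ≥ 0 := by
        have : 0 ≤ c := (abs_nonneg _).trans hc
        positivity
      have hsum : ((((K + n : ℕ) : ℝ) + 2) * (((K + n : ℕ) : ℝ) + 2 + 1) + c)
            * |frobCoeff 1 b (K + n + 2)|
          + 8 * π ^ 2 * |frobCoeff 1 b (K + n + 1)| + 4 * π ^ 2 * |frobCoeff 1 b (K + n)|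
          ≤ B * q ^ (K + n) * (((((K + n : ℕ) : ℝ) + 2) * (((K + n : ℕ) : ℝ) + 2 + 1) + c) * q ^ 2
              + 8 * π ^ 2 * q + 4 * π ^ 2) := by
        have ea : B * q ^ (K + n + 2) = B * q ^ (K + n) * q ^ 2 := by ring
        have eb : B * q ^ (K + n + 1) = B * q ^ (K + n) * q := by ring
        rw [ea] at hcc; rw [eb] at hb
        nlinarith [mul_le_mul_of_nonneg_left hcc hrhs, hb, ha, Real.pi_pos]
      have hcr' : ((((K + n : ℕ) : ℝ) + 2) * (((K + n : ℕ) : ℝ) + 2 + 1) + c) * q ^ 2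
          + 8 * π ^ 2 * q + 4 * π ^ 2 ≤ 2 * ((((K + n : ℕ) : ℝ) + 2) + 1) ^ 2 * q ^ 3 := by
        have := hcr; push_cast at this ⊢; linarith
      have hfin : 2 * (((K + n : ℕ) : ℝ) + 2 + 1) ^ 2 * |frobCoeff 1 b (K + n + 2 + 1)|
          ≤ 2 * (((K + n : ℕ) : ℝ) + 2 + 1) ^ 2 * (B * q ^ (K + n + 3)) := by
        calc 2 * (((K + n : ℕ) : ℝ) + 2 + 1) ^ 2 * |frobCoeff 1 b (K + n + 2 + 1)|
            ≤ B * q ^ (K + n) * (((((K + n : ℕ) : ℝ) + 2) * (((K + n : ℕ) : ℝ) + 2 + 1) + c) * q ^ 2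
              + 8 * π ^ 2 * q + 4 * π ^ 2) := hstep.trans hsum
          _ ≤ B * q ^ (K + n) * (2 * ((((K + n : ℕ) : ℝ) + 2) + 1) ^ 2 * q ^ 3) :=
              mul_le_mul_of_nonneg_left hcr' (by positivity)
          _ = 2 * (((K + n : ℕ) : ℝ) + 2 + 1) ^ 2 * (B * q ^ (K + n + 3)) := by ring
      have hpos : 0 < 2 * (((K + n : ℕ) : ℝ) + 2 + 1) ^ 2 := by positivity
      exact le_of_mul_le_mul_left hfin hpos
  intro k hk
  obtain ⟨n, rfl⟩ := Nat.exists_eq_add_of_le hk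
  exact (key n).1

/-- **The tail constant**: under the hypotheses of `abs_frobCoeff_le_geometric` with `q < 1`,
`Σ_j |a_{j+K}| ≤ B q^K/(1−q)`. [cite: CoddingtonLevinson1955, Ch. 4 §8] -/
theorem tsum_abs_frobCoeff_add_le {b B q : ℝ} {K : ℕ} (hq : 0 < q) (hq1 : q < 1)
    (hgeom : ∀ k : ℕ, K ≤ k → |frobCoeff 1 b k| ≤ B * q ^ k) :
    ∑' j, |frobCoeff 1 b (j + K)| ≤ B * q ^ K / (1 - q) := by
  have hg : HasSum (fun j : ℕ ↦ B * q ^ K * q ^ j) (B * q ^ K * (1 - q)⁻¹) :=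
    (hasSum_geometric_of_lt_one hq.le hq1).mul_left _
  have hle : ∀ j, |frobCoeff 1 b (j + K)| ≤ B * q ^ K * q ^ j := fun j ↦ by
    have := hgeom (j + K) (by omega)
    calc |frobCoeff 1 b (j + K)| ≤ B * q ^ (j + K) := this
      _ = B * q ^ K * q ^ j := by rw [pow_add]; ring
  have hs : Summable (fun j ↦ |frobCoeff 1 b (j + K)|) :=
    Summable.of_nonneg_of_le (fun j ↦ abs_nonneg _) hle hg.summable
  calc ∑' j, |frobCoeff 1 b (j + K)| ≤ ∑' j : ℕ, B * q ^ K * q ^ j :=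
        hs.tsum_le_tsum hle hg.summable
    _ = B * q ^ K * (1 - q)⁻¹ := hg.tsum_eq
    _ = B * q ^ K / (1 - q) := by rw [div_eq_mul_inv]

/-- **Checking the criterion at one index suffices**: the criterion is `f(k) ≥ 0` for the quadratic
`f(k) = 2(k+1)²q³ − (k(k+1)+c)q² − 8π²q − 4π²`, whose discrete derivative
`f(k+1) − f(k) = (2k+3)·2q³ − 2(k+1)q²` is `≥ 0` once `q ≥ ½`; so `f(K₀) ≥ 0` and `q ≥ ½` give it
for all `k ≥ K₀`. [cite: CoddingtonLevinson1955, Ch. 4 §8] -/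
theorem criterion_of_quadratic {c q : ℝ} {K₀ : ℕ} (hq : 1 / 2 ≤ q)
    (hK₀ : (((K₀ : ℝ) * ((K₀ : ℝ) + 1) + c) * q ^ 2 + 8 * π ^ 2 * q + 4 * π ^ 2)
      ≤ 2 * ((K₀ : ℝ) + 1) ^ 2 * q ^ 3) :
    ∀ k : ℕ, K₀ ≤ k →
      (((k : ℝ) * ((k : ℝ) + 1) + c) * q ^ 2 + 8 * π ^ 2 * q + 4 * π ^ 2)
        ≤ 2 * ((k : ℝ) + 1) ^ 2 * q ^ 3 := by
  intro k hk
  obtain ⟨n, rfl⟩ := Nat.exists_eq_add_of_le hk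
  induction n with
  | zero => simpa using hK₀
  | succ n ih =>
    have ih' := ih (by omega)
    push_cast at ih' ⊢
    have hq0 : 0 ≤ q := by linarith
    have hm : (0 : ℝ) ≤ ((K₀ : ℝ) + (n : ℝ)) := by positivity
    -- f(m+1) - f(m) = 2q²((2m+3)q − (m+1)) ≥ 0 since q ≥ 1/2
    nlinarith [mul_nonneg (mul_nonneg hq0 hq0)
      (by nlinarith : (0:ℝ) ≤ (2 * ((K₀ : ℝ) + n) + 3) * q - (((K₀ : ℝ) + n) + 1))]

end Literature.NumberTheory.LFunctions

end
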